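import Mathlib
import HarnessLib

/-!
# Gluing `C¹` pieces on consecutive closed intervals: a spline that is `C¹` on every closed bin is `C¹` on the whole knot range

HONEST FRAMING: exact (Metropolis-corrected) sampling algorithms for lattice gauge theory;
figures of merit are autocorrelation/cost numbers at stated couplings and volumes; no
continuum-physics claim.

Venture `LatticeQCDFlow` (cell pub-lqcd), topic `Exactness`; FANOUT row 10 (`eng-equiv`, engine
`latflow.equiv`, module `equiv/splines.py`: a `K`-bin spline is evaluated by locating the bin of
`x` and applying that bin's closed form; its log-derivative is the bin's closed-form derivative).
NEW WORK of the cell over Mathlib (one-sided derivatives `HasDerivWithinAt` on closed intervals,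
`nhdsWithin`, `ContinuousOn.union_of_isClosed`); nothing is cited as a fact; no number; no
definition is introduced.  Printed counterparts, NAMED ONLY: Gregory–Delbourgo 1982, Durkan et
al. 2019 (monotone splines are `C¹` across the knots because consecutive bins share the knot
value and the knot derivative).

## Why this file

The exactness certificate of a circular spline coupling (`CircularSplineJacobian.lean`) consumes
ONE profile `g` on `[0,1]` with `HasDerivWithinAt g (g' u) [0,1] u` at every `u ∈ [0,1]` and
`ContinuousOn g' [0,1]`.  The engine's profile is assembled from `K` bins; on each CLOSED bin
`[X k, X (k+1)]` it is a closed form whose derivative there is known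
(`RationalQuadraticSpline.lean`).  Because the spline is built so that consecutive closed forms
AGREE at the shared knot in value and in slope, one function `g` and one function `g'` carry all
bins at once, and the only remaining step is topological: derivatives within consecutive closed
intervals glue to a derivative within their union.  That step is recorded here once, for any
real function and any finite monotone knot sequence `X : ℕ → ℝ`.

## Content

* `hasDerivWithinAt_Icc_union_knot` — at a shared knot `b`, derivatives within `[a,b]` and
  within `[b,c]` (same value) give the derivative within `[a,c]` (`HasDerivWithinAt.union`);
* `hasDerivWithinAt_Icc_of_left_piece` / `hasDerivWithinAt_Icc_of_right_piece` — away from the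
  knot the smaller closed interval is a neighbourhood within the larger one;
* **`hasDerivWithinAt_Icc_glue`** — if for every bin `k < K` and every `x ∈ [X k, X (k+1)]`,
  `HasDerivWithinAt g (g' x) [X k, X (k+1)] x`, then for every `x ∈ [X 0, X K]`,
  `HasDerivWithinAt g (g' x) [X 0, X K] x` (induction on `K`);
* **`continuousOn_Icc_glue`** — `ContinuousOn g'` on every closed bin gives `ContinuousOn g'` on
  `[X 0, X K]`;
* `exists_bin_of_mem_Icc` — every point of `[X 0, X (K+1)]` lies in some closed bin;
  `exists_glued_fun` — NON-VACUITY of the hypothesis shape "`G` agrees with the closed form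
  `φ k` on every closed bin": with strictly increasing knots and closed forms that agree at the
  shared knots, such a `G` exists;
  `hasDerivAt_of_hasDerivWithinAt_Icc_interior` — at interior points of the knot range the glued
  within-derivative is a derivative.

NOT here: any particular spline (the bins' closed forms and their knot matching are the
caller's; for the rational-quadratic family see `RationalQuadraticSpline.lean`).
-/

noncomputable section

namespace Summit.Ventures.LatticeQCDFlow.Exactness

open Set Filter Topology

section TwoPieces

variable {g : ℝ → ℝ} {e a b c x : ℝ}

/-- **At a shared knot**: derivatives within `[a,b]` and within `[b,c]` at `b`, with the same
value, give the derivative within `[a,c]` at `b`. -/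
theorem hasDerivWithinAt_Icc_union_knot (hab : a ≤ b) (hbc : b ≤ c)
    (hl : HasDerivWithinAt g e (Icc a b) b) (hr : HasDerivWithinAt g e (Icc b c) b) :
    HasDerivWithinAt g e (Icc a c) b := by
  have h := hl.union hr
  rwa [Icc_union_Icc_eq_Icc hab hbc] at h

/-- **Left piece, away from the knot**: at `x ∈ [a,b)` the interval `[a,b]` is a neighbourhood of
`x` within `[a,c]`, so a derivative within `[a,b]` is a derivative within `[a,c]`. -/
theorem hasDerivWithinAt_Icc_of_left_piece (hx : x < b)
    (h : HasDerivWithinAt g e (Icc a b) x) : HasDerivWithinAt g e (Icc a c) x := by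
  refine h.mono_of_mem_nhdsWithin ?_
  refine mem_nhdsWithin_iff_exists_mem_nhds_inter.2 ⟨Iio b, Iio_mem_nhds hx, ?_⟩
  rintro y ⟨hyb, hy⟩
  exact ⟨hy.1, le_of_lt hyb⟩

/-- **Right piece, away from the knot**: at `x ∈ (b,c]` a derivative within `[b,c]` is a
derivative within `[a,c]`. -/
theorem hasDerivWithinAt_Icc_of_right_piece (hx : b < x)
    (h : HasDerivWithinAt g e (Icc b c) x) : HasDerivWithinAt g e (Icc a c) x := by
  refine h.mono_of_mem_nhdsWithin ?_
  refine mem_nhdsWithin_iff_exists_mem_nhds_inter.2 ⟨Ioi b, Ioi_mem_nhds hx, ?_⟩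
  rintro y ⟨hyb, hy⟩
  exact ⟨le_of_lt hyb, hy.2⟩

end TwoPieces

section Glue

variable {g g' : ℝ → ℝ} {X : ℕ → ℝ}

/-- Monotone consecutive knots are monotone: `X 0 ≤ X k` for `k ≤ K`. -/
theorem knot_zero_le {K : ℕ} (hX : ∀ k < K, X k ≤ X (k + 1)) {k : ℕ} (hk : k ≤ K) :
    X 0 ≤ X k := by
  induction k with
  | zero => exact le_rfl
  | succ k ih => exact (ih (Nat.le_of_succ_le hk)).trans (hX k (Nat.lt_of_succ_le hk))

/-- **Gluing within-derivatives along a knot sequence.**  Let `X 0 ≤ X 1 ≤ ⋯ ≤ X K` and suppose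
that on every closed bin the function `g` has the within-derivative `g'`:
`∀ k < K, ∀ x ∈ [X k, X (k+1)], HasDerivWithinAt g (g' x) [X k, X (k+1)] x`.  Then
`∀ x ∈ [X 0, X K], HasDerivWithinAt g (g' x) [X 0, X K] x` — the spline is `C¹` across every
interior knot (with one-sided derivatives at the two ends). -/
theorem hasDerivWithinAt_Icc_glue :
    ∀ (K : ℕ), (∀ k < K, X k ≤ X (k + 1)) →
      (∀ k < K, ∀ x ∈ Icc (X k) (X (k + 1)), HasDerivWithinAt g (g' x) (Icc (X k) (X (k + 1))) x) →
      ∀ x ∈ Icc (X 0) (X K), HasDerivWithinAt g (g' x) (Icc (X 0) (X K)) x := by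
  intro K
  induction K with
  | zero =>
    intro _ _ x hx
    -- the degenerate range `[X 0, X 0]` is a single point: any value is a within-derivative
    have hx0 : x = X 0 := le_antisymm hx.2 hx.1
    subst hx0
    rw [Icc_self]
    exact hasDerivWithinAt_iff_hasFDerivWithinAt.2 HasFDerivWithinAt.singleton
  | succ K ih =>
    intro hX hbin x hx
    have hX' : ∀ k < K, X k ≤ X (k + 1) := fun k hk => hX k (Nat.lt_succ_of_lt hk)
    have hbin' : ∀ k < K, ∀ x ∈ Icc (X k) (X (k + 1)),
        HasDerivWithinAt g (g' x) (Icc (X k) (X (k + 1))) x :=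
      fun k hk => hbin k (Nat.lt_succ_of_lt hk)
    have h0K : X 0 ≤ X K := knot_zero_le hX' le_rfl
    have hKK : X K ≤ X (K + 1) := hX K (Nat.lt_succ_self K)
    rcases lt_trichotomy x (X K) with hlt | heq | hgt
    · exact hasDerivWithinAt_Icc_of_left_piece hlt (ih hX' hbin' x ⟨hx.1, hlt.le⟩)
    · subst heq
      exact hasDerivWithinAt_Icc_union_knot h0K hKK (ih hX' hbin' _ ⟨h0K, le_rfl⟩)
        (hbin K (Nat.lt_succ_self K) _ ⟨le_rfl, hKK⟩)
    · exact hasDerivWithinAt_Icc_of_right_piece hgt (hbin K (Nat.lt_succ_self K) x ⟨hgt.le, hx.2⟩)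

/-- **Gluing continuity of the derivative**: `ContinuousOn g'` on every closed bin gives
`ContinuousOn g'` on the knot range `[X 0, X K]` (finite union of closed sets). -/
theorem continuousOn_Icc_glue :
    ∀ (K : ℕ), (∀ k < K, X k ≤ X (k + 1)) →
      (∀ k < K, ContinuousOn g' (Icc (X k) (X (k + 1)))) → ContinuousOn g' (Icc (X 0) (X K)) := by
  intro K
  induction K with
  | zero =>
    intro _ _
    rw [Icc_self]
    exact continuousOn_singleton g' (X 0)
  | succ K ih =>
    intro hX hbin
    have hX' : ∀ k < K, X k ≤ X (k + 1) := fun k hk => hX k (Nat.lt_succ_of_lt hk)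
    have h0K : X 0 ≤ X K := knot_zero_le hX' le_rfl
    have hKK : X K ≤ X (K + 1) := hX K (Nat.lt_succ_self K)
    have h := (ih hX' fun k hk => hbin k (Nat.lt_succ_of_lt hk)).union_of_isClosed
      (hbin K (Nat.lt_succ_self K)) isClosed_Icc isClosed_Icc
    rwa [Icc_union_Icc_eq_Icc h0K hKK] at h

/-- **Every point of the knot range lies in a closed bin** (`K + 1 ≥ 1` bins; no monotonicity
needed). -/
theorem exists_bin_of_mem_Icc :
    ∀ (K : ℕ), ∀ x ∈ Icc (X 0) (X (K + 1)), ∃ k < K + 1, x ∈ Icc (X k) (X (k + 1)) := by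
  intro K
  induction K with
  | zero => exact fun x hx => ⟨0, Nat.zero_lt_one, hx⟩
  | succ K ih =>
    intro x hx
    by_cases hle : x ≤ X (K + 1)
    · obtain ⟨k, hk, hmem⟩ := ih x ⟨hx.1, hle⟩
      exact ⟨k, Nat.lt_succ_of_lt hk, hmem⟩
    · exact ⟨K + 1, Nat.lt_succ_self _, (not_le.1 hle).le, hx.2⟩

/-- Strictly increasing consecutive knots are strictly increasing: `X i < X j` for
`i < j ≤ K`. -/
theorem knot_lt_of_lt {K : ℕ} (hX : ∀ k < K, X k < X (k + 1)) :
    ∀ {i j : ℕ}, i < j → j ≤ K → X i < X j := by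
  intro i j hij hjK
  induction j with
  | zero => exact absurd hij (Nat.not_lt_zero i)
  | succ j ih =>
    have hjK' : j < K := Nat.lt_of_succ_le hjK
    rcases Nat.lt_succ_iff_lt_or_eq.1 hij with h | h
    · exact (ih h hjK'.le).trans (hX j hjK')
    · subst h; exact hX i hjK'

/-- **Non-vacuity of "agrees with the bin's closed form on every closed bin"**: closed forms
`φ k` prescribed on consecutive closed bins with STRICTLY increasing knots, which agree at each
shared knot (`φ k (X (k+1)) = φ (k+1) (X (k+1))`), are all restrictions of ONE function. -/
theorem exists_glued_fun {φ : ℕ → ℝ → ℝ} :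
    ∀ (K : ℕ), (∀ k < K, X k < X (k + 1)) →
      (∀ k, k + 1 < K → φ k (X (k + 1)) = φ (k + 1) (X (k + 1))) →
      ∃ G : ℝ → ℝ, ∀ k < K, ∀ x ∈ Icc (X k) (X (k + 1)), G x = φ k x := by
  intro K
  induction K with
  | zero => exact fun _ _ => ⟨fun _ => 0, fun k hk => absurd hk (Nat.not_lt_zero k)⟩
  | succ K ih =>
    intro hX hmatch
    obtain ⟨G₀, hG₀⟩ := ih (fun k hk => hX k (Nat.lt_succ_of_lt hk))
      (fun k hk => hmatch k (Nat.lt_succ_of_lt hk))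
    classical
    refine ⟨fun x => if x < X K then G₀ x else φ K x, fun k hk x hx => ?_⟩
    rcases Nat.lt_succ_iff_lt_or_eq.1 hk with hkK | hkK
    · -- an earlier bin: `x ≤ X (k+1) ≤ X K`, with equality only at the shared knot `X K`
      have hle : X (k + 1) ≤ X K := by
        rcases (Nat.succ_le_of_lt hkK).lt_or_eq with h | h
        · exact (knot_lt_of_lt hX h (Nat.le_succ K)).le
        · exact (congrArg X h).le
      by_cases hxlt : x < X K
      · simp only [if_pos hxlt]
        exact hG₀ k hkK x hx
      · simp only [if_neg hxlt]
        have hxe : x = X K := le_antisymm (hx.2.trans hle) (not_lt.1 hxlt)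
        have hke : X (k + 1) = X K := le_antisymm hle (hxe ▸ hx.2)
        -- strictly increasing knots: `k + 1 = K`
        have hk1 : k + 1 = K := by
          by_contra hne
          have hlt : k + 1 < K := lt_of_le_of_ne (Nat.succ_le_of_lt hkK) hne
          exact (knot_lt_of_lt hX hlt (Nat.le_succ K)).ne hke
        subst hk1
        rw [hxe]
        exact (hmatch k (Nat.lt_succ_self _)).symm
    · subst hkK
      have hxlt : ¬ x < X k := not_lt.2 hx.1
      simp only [if_neg hxlt]

/-- At an interior point of the knot range the glued within-derivative is a derivative. -/
theorem hasDerivAt_of_hasDerivWithinAt_Icc_interior {a b x e : ℝ} (hx : x ∈ Ioo a b)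
    (h : HasDerivWithinAt g e (Icc a b) x) : HasDerivAt g e x :=
  h.hasDerivAt (Icc_mem_nhds hx.1 hx.2)

end Glue

end Summit.Ventures.LatticeQCDFlow.Exactness
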